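/-
Copyright (c) 2026. All rights reserved.
Released under Apache 2.0 license as described in the file LICENSE.
Authors: abc-iut cell, prover seat abc-iut-w5-d144 (gen 6; row «COR510iv-SB′», brick E input «D2a-EMB», TS half), after abc-iut-w5-d053's
`plusToTS` lemmas (`LogFrobeniusObservablesTSOfPlus.lean`), for this seat's embeddings `embMonoPlus` / `embMonoTS` (p484312).
-/
import Literature.AnabelianGeometry.AbsoluteAnabelian.LogFrobeniusMonoTelecoreObservables
import Literature.AnabelianGeometry.AbsoluteAnabelian.StrictHomotopyFamilies
import Literature.AnabelianGeometry.AbsoluteAnabelian.DiagramPathEmbeddings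
import HarnessLib

/-!
# [AbsTopIII] Cor 5.10 (iv)(b): the embedding of the `TS`-observable's diagram into the telecore diagram `D_{An⊢}` — bookkeeping

S. Mochizuki, *Topics in absolute anabelian geometry III*, J. Math. Sci. Univ. Tokyo 22 (2015) [MochizukiAbsTopIII2015];
manuscript `paper:url-5493eb38cbb7`: Cor 5.10 (iv)(b) pp. 147–148, Cor 5.5 (iii) p. 131, Def 3.5 (i) pp. 74–75.

PROOF-ONLY bookkeeping for abc-iut-f-101's brick D2 («sink at `𝒩⊞_v` = `Hplus v` transported along `embMonoPlus`;
mapPath-injective + path lifting») about this seat's graph embeddings of p484312 (`embMonoPlus J v`, `embMonoTS J v`),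
transposing abc-iut-w5-d053's `plusToTS_*` lemmas (`LogFrobeniusObservablesTSOfPlus.lean`): injectivity on objects /
arrows / paths; PATH LIFTING (`exists_eq_embMonoPlus_mapPath`, `exists_eq_embMonoTS_mapPath`: every path of `Γ⃗_{D_{An⊢}}`
INTO `𝒩⊞_v`, resp. `𝒩_v`, comes from the observable's graph — given `hJ`: telecore edges land at non-holomorphic vertices,
as the printed `φ^{An⊢⊞}_{w,ν} : An⊢ → 𝒩⊢⊞_w` do, `isEmpty_monoTelecoreIdx_of_isHolomorphic`); agreement of the path functors
along the embeddings (`pathFunctor'_embMonoPlus_heq/_eq`, TS twins).  Nothing here bears on [IUTchIII] Cor. 3.12; no side taken.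
-/

universe u

open CategoryTheory Quiver

namespace Literature.AnabelianGeometry.AbsoluteAnabelian

namespace LogFrobeniusSetting

variable {Vmod : Type u} {isArc : Vmod → Bool} (L : LogFrobeniusSetting Vmod isArc)
  (J : DSub (monoBase (Vmod := Vmod) (isArc := isArc) 6) → Type u) (v : Vmod)

/-! ## The `TS`-embedding `embMonoTS` -/

section TS

/-- A vertex of the portion `(D•_{≤3})_v` is not `𝒩_w`. [cite: MochizukiAbsTopIII2015, Cor 5.5 (iii) p. 131] -/
private theorem not_portion_nv (w : Vmod) : ¬ InPortionThree (isArc := isArc) v (.nv w) := by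
  rintro (h | h)
  · exact absurd h.2 (by simp [DVertex.row])
  · cases h

/-- A path of the `TS`-shape starting at the observation vertex `𝒩_v` ends there (no edge leaves `𝒩_v`).
[cite: MochizukiAbsTopIII2015, Definition 3.5 (iii) p.75] -/
private theorem eq_obs_of_path_from_obsTS' :
    ∀ {c : (logShapeTS (isArc := isArc) v).Vertex}, Path (logShapeTS (isArc := isArc) v).obs c →
      c = (logShapeTS (isArc := isArc) v).obs := by
  intro c r
  induction r with
  | nil => rfl
  | cons r e ih =>
    rename_i b c
    subst ih
    cases c with
    | base _ => exact (PEmpty.elim e)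
    | obs => exact (PEmpty.elim e)

/-- `embMonoTS` is injective on objects. [cite: MochizukiAbsTopIII2015, Cor 5.10 (iv)(b) p. 148] -/
theorem embMonoTS_obj_injective : Function.Injective (embMonoTS (isArc := isArc) J v).obj := by
  intro a b h
  cases a with
  | base x =>
    cases b with
    | base y =>
      change ExtVertex.base _ = ExtVertex.base _ at h
      have h0 := ExtVertex.base.inj h
      have h1 : x.1 = y.1 := Subtype.mk.inj h0
      rw [Subtype.ext h1]
    | obs =>
      change ExtVertex.base _ = ExtVertex.base _ at h
      have h0 := ExtVertex.base.inj h
      have h1 : x.1 = .nv v := Subtype.mk.inj h0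
      exact absurd x.2 (by rw [h1]; exact not_portion_nv v v)
  | obs =>
    cases b with
    | base y =>
      change ExtVertex.base _ = ExtVertex.base _ at h
      have h0 := ExtVertex.base.inj h
      have h1 : DVertex.nv v = y.1 := Subtype.mk.inj h0
      exact absurd y.2 (by rw [← h1]; exact not_portion_nv v v)
    | obs => rfl

/-- `embMonoTS` is injective on arrows. [cite: MochizukiAbsTopIII2015, Cor 5.10 (iv)(b) p. 148] -/
theorem embMonoTS_map_injective {a b : (logShapeTS (isArc := isArc) v).Vertex} :
    Function.Injective ((embMonoTS (isArc := isArc) J v).map : (a ⟶ b) → _) := by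
  intro e e' h
  cases a with
  | base x =>
    cases b with
    | base y => exact h
    | obs => exact h
  | obs => exact (PEmpty.elim (show PEmpty from by cases b <;> exact e))

/-- `embMonoTS` is injective on paths. [cite: MochizukiAbsTopIII2015, Cor 5.10 (iv)(b) p. 148] -/
theorem embMonoTS_mapPath_injective {a : (logShapeTS (isArc := isArc) v).Vertex} :
    ∀ {b : (logShapeTS (isArc := isArc) v).Vertex} (p q : Path a b),
      (embMonoTS (isArc := isArc) J v).mapPath p = (embMonoTS J v).mapPath q → p = q
  | _, Path.nil, q, h => by
    cases q with
    | nil => rfl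
    | cons q e =>
      have hl := congrArg Path.length h
      simp [Prefunctor.mapPath_cons, Path.length_cons] at hl
  | _, Path.cons p e, q, h => by
    cases q with
    | nil =>
      have hl := congrArg Path.length h
      simp [Prefunctor.mapPath_cons, Path.length_cons] at hl
    | cons q e' =>
      rw [Prefunctor.mapPath_cons, Prefunctor.mapPath_cons] at h
      obtain ⟨hcc, hpq, hee⟩ := Path.cons.inj h
      cases embMonoTS_obj_injective J v hcc
      cases embMonoTS_map_injective J v (eq_of_heq hee)
      rw [embMonoTS_mapPath_injective p q (eq_of_heq hpq)]

/-- **PATH LIFTING for `embMonoTS`**: every path of `Γ⃗_{D_{An⊢}}` ending at a vertex of the portion `(D•_{≤3})_v` or at `𝒩_v`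
starts at such a vertex and is the image of a path of `Γ⃗_{(D•_{≤3})_v ∪ {𝒩_v}}` — PROVIDED the telecore edges land at
non-holomorphic vertices only (`hJ`). [cite: MochizukiAbsTopIII2015, Cor 5.10 (iv)(b) p. 148] -/
theorem exists_eq_embMonoTS_mapPath (hJ : ∀ a : DSub (monoBase (Vmod := Vmod) (isArc := isArc) 6), a.1.IsHolomorphic →
      IsEmpty (J a))
    {c t : (monoTelecoreShape (Vmod := Vmod) (isArc := isArc) J).Vertex} (r : Path c t) :
    ∀ (x : (logShapeTS (isArc := isArc) v).Vertex), t = (embMonoTS J v).obj x →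
      ∃ (y : (logShapeTS (isArc := isArc) v).Vertex) (_ : c = (embMonoTS J v).obj y)
        (r₀ : Path y x), HEq r ((embMonoTS J v).mapPath r₀) := by
  induction r with
  | nil => intro x ht; exact ⟨x, ht, Path.nil, by subst ht; rfl⟩
  | cons r e ih =>
    rename_i d t
    intro x ht
    subst ht
    cases x with
    | obs =>
      -- last edge into `𝒩_v`: `𝒩⊞_v → 𝒩_v`, or a telecore edge (excluded by `hJ`)
      cases d with
      | obs => exact ((hJ ⟨.nv v, monoBase_six_nv v⟩ trivial).elim e)
      | base z =>
        obtain ⟨zv, hz⟩ := z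
        change DEdge isArc zv (.nv v) at e
        cases e with
        | forget w =>
          obtain ⟨y, hc, r₀, hr⟩ := ih ((logShapeTS v).base ⟨.nplus v, nplus_mem_portion v⟩) rfl
          refine ⟨y, hc, r₀.cons (forgetEdgeTS v), ?_⟩
          subst hc
          cases eq_of_heq hr
          rfl
    | base xx =>
      obtain ⟨xv, hx⟩ := xx
      cases d with
      | obs =>
        refine ((hJ ⟨xv, monoBase_six_of_inPortionThree hx⟩ ?_).elim e)
        rcases hx with h | h
        · exact h.1
        · subst h; trivial
      | base z =>
        obtain ⟨zv, hz⟩ := z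
        change DEdge isArc zv xv at e
        cases e with
        | log n =>
          obtain ⟨y, hc, r₀, hr⟩ := ih ((logShapeTS v).base ⟨.row1 (n + 1), row1_mem_portion v (n + 1)⟩) rfl
          refine ⟨y, hc, r₀.cons (show (logShapeTS (isArc := isArc) v).base ⟨.row1 (n + 1), row1_mem_portion v (n + 1)⟩ ⟶
            (logShapeTS v).base ⟨.row1 n, hx⟩ from DEdge.log n), ?_⟩
          subst hc
          cases eq_of_heq hr
          rfl
        | toCore n =>
          obtain ⟨y, hc, r₀, hr⟩ := ih ((logShapeTS v).base ⟨.row1 n, row1_mem_portion v n⟩) rfl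
          refine ⟨y, hc, r₀.cons (show (logShapeTS (isArc := isArc) v).base ⟨.row1 n, row1_mem_portion v n⟩ ⟶
            (logShapeTS v).base ⟨.core, hx⟩ from DEdge.toCore n), ?_⟩
          subst hc
          cases eq_of_heq hr
          rfl
        | lam w ν hν =>
          -- `λ⊞_{w,ν}` enters `𝒩⊞_w`; inside the portion only for `w = v`
          have hw : w = v := by
            rcases hx with h | h
            · exact absurd h.2 (by simp [DVertex.row])
            · cases h; rfl
          subst hw
          obtain ⟨y, hc, r₀, hr⟩ := ih ((logShapeTS w).base ⟨.core, core_mem_portion w⟩) rfl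
          refine ⟨y, hc, r₀.cons (show (logShapeTS (isArc := isArc) w).base ⟨.core, core_mem_portion w⟩ ⟶
            (logShapeTS w).base ⟨.nplus w, hx⟩ from DEdge.lam w ν hν), ?_⟩
          subst hc
          cases eq_of_heq hr
          rfl
        | forget w => exact absurd hx (not_portion_nv v w)
        | toE w => exact absurd hx (by rintro (h | h) <;> [exact absurd h.2 (by simp [DVertex.row]); cases h])
        | κAn => exact absurd hx (by rintro (h | h) <;> [exact absurd h.2 (by simp [DVertex.row]); cases h])
        | anToE => exact absurd hx (by rintro (h | h) <;> [exact absurd h.2 (by simp [DVertex.row]); cases h])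
        | monoNplus w => exact absurd hx (by rintro (h | h) <;> [exact absurd h.1 (by simp [DVertex.IsHolomorphic]); cases h])
        | monoN w => exact absurd hx (by rintro (h | h) <;> [exact absurd h.1 (by simp [DVertex.IsHolomorphic]); cases h])
        | monoE5 => exact absurd hx (by rintro (h | h) <;> [exact absurd h.1 (by simp [DVertex.IsHolomorphic]); cases h])
        | monoAn => exact absurd hx (by rintro (h | h) <;> [exact absurd h.1 (by simp [DVertex.IsHolomorphic]); cases h])
        | monoE7 => exact absurd hx (by rintro (h | h) <;> [exact absurd h.1 (by simp [DVertex.IsHolomorphic]); cases h])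
        | forgetMono w => exact absurd hx (by rintro (h | h) <;> [exact absurd h.1 (by simp [DVertex.IsHolomorphic]); cases h])
        | toEmono w => exact absurd hx (by rintro (h | h) <;> [exact absurd h.1 (by simp [DVertex.IsHolomorphic]); cases h])
        | κAnMono => exact absurd hx (by rintro (h | h) <;> [exact absurd h.1 (by simp [DVertex.IsHolomorphic]); cases h])
        | anMonoToE => exact absurd hx (by rintro (h | h) <;> [exact absurd h.1 (by simp [DVertex.IsHolomorphic]); cases h])

/-- `embMonoTS` is an EMBEDDING of oriented graphs (abc-iut-f-101's `GraphEmbedding`). [cite: MochizukiAbsTopIII2015, Section 0 p.26] -/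
theorem graphEmbedding_embMonoTS : DiagramOfCategories.GraphEmbedding (embMonoTS (isArc := isArc) J v) :=
  ⟨embMonoTS_obj_injective J v, fun {_ _} => embMonoTS_map_injective J v⟩

/-- `embMonoTS` is a SIEVE (abc-iut-f-101's `IsSieve`: every arrow of `Γ⃗_{D_{An⊢}}` INTO `(D•_{≤3})_v ∪ {𝒩_v}` comes from it),
provided the telecore edges land at non-holomorphic vertices (`hJ`). [cite: MochizukiAbsTopIII2015, Section 0 p.26] -/
theorem isSieve_embMonoTS (hJ : ∀ a : DSub (monoBase (Vmod := Vmod) (isArc := isArc) 6), a.1.IsHolomorphic →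
      IsEmpty (J a)) : DiagramOfCategories.IsSieve (embMonoTS (isArc := isArc) J v) := by
  intro c b' e
  cases b' with
  | obs =>
    cases c with
    | obs => exact ((hJ ⟨.nv v, monoBase_six_nv v⟩ trivial).elim e)
    | base z =>
      obtain ⟨zv, hz⟩ := z
      change DEdge isArc zv (.nv v) at e
      cases e with
      | forget w => exact ⟨(logShapeTS v).base ⟨.nplus v, nplus_mem_portion v⟩, forgetEdgeTS v, rfl, HEq.rfl⟩
  | base xx =>
    obtain ⟨xv, hx⟩ := xx
    cases c with
    | obs =>
      refine ((hJ ⟨xv, monoBase_six_of_inPortionThree hx⟩ ?_).elim e)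
      rcases hx with h | h
      · exact h.1
      · subst h; trivial
    | base z =>
      obtain ⟨zv, hz⟩ := z
      change DEdge isArc zv xv at e
      cases e with
      | log n => exact ⟨(logShapeTS v).base ⟨.row1 (n + 1), row1_mem_portion v (n + 1)⟩,
          (show (logShapeTS (isArc := isArc) v).base ⟨.row1 (n + 1), row1_mem_portion v (n + 1)⟩ ⟶
            (logShapeTS v).base ⟨.row1 n, hx⟩ from DEdge.log n), rfl, HEq.rfl⟩
      | toCore n => exact ⟨(logShapeTS v).base ⟨.row1 n, row1_mem_portion v n⟩,
          (show (logShapeTS (isArc := isArc) v).base ⟨.row1 n, row1_mem_portion v n⟩ ⟶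
            (logShapeTS v).base ⟨.core, hx⟩ from DEdge.toCore n), rfl, HEq.rfl⟩
      | lam w ν hν =>
        have hw : w = v := by
          rcases hx with h | h
          · exact absurd h.2 (by simp [DVertex.row])
          · cases h; rfl
        subst hw
        exact ⟨(logShapeTS w).base ⟨.core, core_mem_portion w⟩,
          (show (logShapeTS (isArc := isArc) w).base ⟨.core, core_mem_portion w⟩ ⟶
            (logShapeTS w).base ⟨.nplus w, hx⟩ from DEdge.lam w ν hν), rfl, HEq.rfl⟩
      | forget w => exact absurd hx (not_portion_nv v w)
      | toE w => exact absurd hx (by rintro (h | h) <;> [exact absurd h.2 (by simp [DVertex.row]); cases h])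
      | κAn => exact absurd hx (by rintro (h | h) <;> [exact absurd h.2 (by simp [DVertex.row]); cases h])
      | anToE => exact absurd hx (by rintro (h | h) <;> [exact absurd h.2 (by simp [DVertex.row]); cases h])
      | monoNplus w => exact absurd hx (by rintro (h | h) <;> [exact absurd h.1 (by simp [DVertex.IsHolomorphic]); cases h])
      | monoN w => exact absurd hx (by rintro (h | h) <;> [exact absurd h.1 (by simp [DVertex.IsHolomorphic]); cases h])
      | monoE5 => exact absurd hx (by rintro (h | h) <;> [exact absurd h.1 (by simp [DVertex.IsHolomorphic]); cases h])
      | monoAn => exact absurd hx (by rintro (h | h) <;> [exact absurd h.1 (by simp [DVertex.IsHolomorphic]); cases h])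
      | monoE7 => exact absurd hx (by rintro (h | h) <;> [exact absurd h.1 (by simp [DVertex.IsHolomorphic]); cases h])
      | forgetMono w => exact absurd hx (by rintro (h | h) <;> [exact absurd h.1 (by simp [DVertex.IsHolomorphic]); cases h])
      | toEmono w => exact absurd hx (by rintro (h | h) <;> [exact absurd h.1 (by simp [DVertex.IsHolomorphic]); cases h])
      | κAnMono => exact absurd hx (by rintro (h | h) <;> [exact absurd h.1 (by simp [DVertex.IsHolomorphic]); cases h])
      | anMonoToE => exact absurd hx (by rintro (h | h) <;> [exact absurd h.1 (by simp [DVertex.IsHolomorphic]); cases h])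

variable (tel : ∀ {a : DSub (monoBase (Vmod := Vmod) (isArc := isArc) 6)}, J a → (L.AnMono ⥤ a.1.category L))

/-- The path functors of `D_{An⊢}` along a `TS`-embedded path are those of the `TS`-observable's diagram (structural variants).
[cite: MochizukiAbsTopIII2015, Definition 3.5 (i) pp.74–75] -/
theorem pathFunctor'_embMonoTS_heq {a : (logShapeTS (isArc := isArc) v).Vertex} :
    ∀ {b : (logShapeTS (isArc := isArc) v).Vertex} (p : Path a b),
      HEq ((L.monoTelecoreDiagram J tel).pathFunctor' ((embMonoTS J v).mapPath p)) ((L.logDiagramTS v).pathFunctor' p)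
  | _, Path.nil => by cases a <;> exact HEq.rfl
  | _, Path.cons (b := b) (c := c) p e => by
    have ih := pathFunctor'_embMonoTS_heq p
    rw [Prefunctor.mapPath_cons, DiagramOfCategories.pathFunctor'_cons, DiagramOfCategories.pathFunctor'_cons]
    cases b with
    | obs => cases c <;> exact (PEmpty.elim e)
    | base y =>
      cases a with
      | obs => exact absurd (eq_obs_of_path_from_obsTS' v p) (fun h => by cases h)
      | base x =>
        cases c with
        | base z => rw [eq_of_heq ih]; rfl
        | obs => rw [eq_of_heq ih]; rfl

/-- For paths from a vertex of the portion into `𝒩_v`: an honest equation with the non-structural path functor of the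
`TS`-observable's diagram. [cite: MochizukiAbsTopIII2015, Definition 3.5 (i) pp.74–75] -/
theorem pathFunctor'_embMonoTS_eq (x : DSub (InPortionThree (isArc := isArc) v))
    (p : Path ((logShapeTS (isArc := isArc) v).base x) (logShapeTS (isArc := isArc) v).obs) :
    (L.monoTelecoreDiagram J tel).pathFunctor' ((embMonoTS J v).mapPath p) = (L.logDiagramTS v).pathFunctor p :=
  (eq_of_heq (L.pathFunctor'_embMonoTS_heq J v tel p)).trans ((L.logDiagramTS v).pathFunctor_eq_pathFunctor' p).symm

/-- The same with the non-structural path functor of `D_{An⊢}` on the left. [cite: MochizukiAbsTopIII2015, Definition 3.5 (i) pp.74–75] -/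
theorem pathFunctor_embMonoTS_eq (x : DSub (InPortionThree (isArc := isArc) v))
    (p : Path ((logShapeTS (isArc := isArc) v).base x) (logShapeTS (isArc := isArc) v).obs) :
    (L.monoTelecoreDiagram J tel).pathFunctor ((embMonoTS J v).mapPath p) = (L.logDiagramTS v).pathFunctor p :=
  ((L.monoTelecoreDiagram J tel).pathFunctor_eq_pathFunctor' _).trans (L.pathFunctor'_embMonoTS_eq J v tel x p)

end TS

/-! ## Appended (same seat, same evening): the observable's diagram IS `D_{An⊢}` pulled back along `embMonoTS` -/

section ComapAlongTS

variable (tel : ∀ {a : DSub (monoBase (Vmod := Vmod) (isArc := isArc) 6)}, J a → (L.AnMono ⥤ a.1.category L))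

/-- Vertex categories agree along `embMonoTS`. [cite: MochizukiAbsTopIII2015, Definition 3.5 (i) p.74] -/
theorem obj_logDiagramTS_eq_embMonoTS (a : (logShapeTS (isArc := isArc) v).Vertex) :
    (L.logDiagramTS v).obj a = (L.monoTelecoreDiagram J tel).obj ((embMonoTS J v).obj a) := by
  cases a <;> rfl

/-- … with the same category structures. [cite: MochizukiAbsTopIII2015, Definition 3.5 (i) p.74] -/
theorem cat_logDiagramTS_heq_embMonoTS (a : (logShapeTS (isArc := isArc) v).Vertex) :
    HEq ((L.logDiagramTS v).cat a) ((L.monoTelecoreDiagram J tel).cat ((embMonoTS J v).obj a)) := by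
  cases a <;> exact HEq.rfl

/-- Edge functors agree along `embMonoTS`. [cite: MochizukiAbsTopIII2015, Definition 3.5 (i) p.74] -/
theorem map_logDiagramTS_heq_embMonoTS {a b : (logShapeTS (isArc := isArc) v).Vertex} (e : a ⟶ b) :
    HEq ((L.logDiagramTS v).map e) ((L.monoTelecoreDiagram J tel).map ((embMonoTS J v).map e)) := by
  cases a with
  | base a =>
    cases b with
    | base b => exact HEq.rfl
    | obs => exact HEq.rfl
  | obs =>
    cases b with
    | base b => exact (PEmpty.elim e : False).elim
    | obs => exact (PEmpty.elim e : False).elim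

/-- ★ **The observable's diagram (observation vertex `𝒩_v`) IS the telecore diagram `D_{An⊢}` pulled back along `embMonoTS`**
(abc-iut-L4-t5's `comapAlong`, via `eq_comapAlong`): the form in which abc-iut-f-101's `DiagramPathEmbeddings` (`LiftPair`,
families on `F^*𝒟`) reads a family of homotopies of the observable inside `D_{An⊢}`.
[cite: MochizukiAbsTopIII2015, Definition 3.5 (i) p.74] -/
theorem logDiagramTS_eq_comapAlong_embMonoTS :
    L.logDiagramTS v = (L.monoTelecoreDiagram J tel).comapAlong (embMonoTS J v) :=
  DiagramOfCategories.eq_comapAlong (L.monoTelecoreDiagram J tel) (embMonoTS J v) (L.obj_logDiagramTS_eq_embMonoTS J v tel)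
    (L.cat_logDiagramTS_heq_embMonoTS J v tel) (fun e => L.map_logDiagramTS_heq_embMonoTS J v tel e)

end ComapAlongTS

end LogFrobeniusSetting

end Literature.AnabelianGeometry.AbsoluteAnabelian
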